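import Literature.NumberTheory.EllipticCurves.IwasawaAlgebraStructureProofs
import Literature.NumberTheory.EllipticCurves.IwasawaAlgebraCharIdealProofs
import Mathlib.NumberTheory.Padics.RingHoms
import Mathlib.LinearAlgebra.Quotient.Pi
import HarnessLib

/-!
# Counting `Λ ⧸ (J, q_m)` at Howard's primes `q_m = T^m + p`: cyclic pieces and the elementary module
# (module theory over `Λ = ℤ_p⟦T⟧`; proofs file)

Topic `NumberTheory/EllipticCurves`. THEOREMS ONLY (no definition, no named fact, no `sorry`), on the vocabulary
of `IwasawaAlgebra.lean` (`IwasawaAlgebra`, `elementaryModule`, `free_quotient_pow`, `finrank_quotient_pow`).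
Written by the LEAD seat of line «twins» on the crux `PrintX10b.BeyondCarrierDepthX10b`
(stmt-BirchSwinnertonDyer-23055; cell `bsd-print-x9`) as part of the algebraic half (piece (E)) of the crux idea
`specialise-first-mu-x10b` (bsd-idea-16): Howard reads the `μ`-part of his divisibility off the specialisations of
the `Λ`-adic Kolyvagin system at the Eisenstein height-one primes `q_m = (T^m + p)` ([Howard 2004], proof of
Thm. 2.2.10, «taking `𝔮 = T^m + p`»); this file computes `#(E ⧸ q_m E)` EXACTLY for the elementary modules
`E(μs, fs) = ⨁ Λ/(p^{μᵢ}) ⊕ ⨁ Λ/(fⱼ^{nⱼ})` of the structure theorem (the comparison of an arbitrary f.g. torsion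
`N ∼ E` with `E` is seat x10b-p1-w2's `IwasawaAlgebraSpecializationIndexComparisonProofs`; the asymptotics and the
`μ`-inequality are `IwasawaAlgebraSpecializationIndexProofs`). HONEST FRAMING: pure `Λ`-module algebra; nothing
about elliptic curves; BSD is not proved by any of this. Conventions: `q_m` is spelled
`PowerSeries.X ^ m + PowerSeries.C (p : ℤ_[p])`, `#(N ⧸ q_m N)` is `Nat.card (N ⧸ (Ideal.span {q_m} • ⊤))`; no new
definitions.

WHAT.
* (`Module.*`, any commutative ring) `card_quotSMulTop_eq_of_linearEquiv`, `finite_quotSMulTop_of_linearEquiv`,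
  `smul_top_eq_pi`, `card_pi_quotSMulTop`, `smul_top_eq_prod`, `card_prod_quotSMulTop`, `card_directSum_quotSMulTop`
  — transport of `#(M ⧸ I M)` under `≃ₗ`; `#((Π Mᵢ) ⧸ I) = ∏ #(Mᵢ ⧸ I)` (and for `×`, `⨁`) over a finite index type.
* `card_quotient_quotSMulTop` — `#((Λ⧸J) ⧸ I) = #(Λ ⧸ (J ⊔ I))`; `card_padicInt_quotSMulTop_pow`,
  `card_quotSMulTop_pow_of_free`, `card_quotient_sup_span_C_pow` — `#(ℤ_p ⧸ p^k) = p^k`, `#(F ⧸ p^k F) = p^{k·rank F}`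
  for a finite free `ℤ_p`-module, hence `#(Λ ⧸ (J, p^k)) = p^{k · rank_{ℤ_p} Λ/J}` when `Λ/J` is `ℤ_p`-free.
* `isDistinguishedAt_X_pow_add_C`, `coe_X_pow_add_C`, `card_quotient_span_qm_sup_span_C_pow` — `X^m + p` is
  distinguished (`m ≥ 1`), so `#(Λ ⧸ (q_m, p^k)) = p^{k m}` (`Λ/(q_m) ≅ ℤ_p[π]`, `π^m = -p`).
* `C_dvd_coe_sub_X_pow`, **`span_coe_sup_span_qm_eq`** — for a distinguished `g` of degree `d < m`,
  `(g, q_m) = (g, p)` in `Λ` (`X^m = X^{m-d}(g - p h₀)`, `p (1 - X^{m-d} h₀) = q_m - X^{m-d} g`, `1 - X^{m-d} h₀ ∈ Λˣ`);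
  hence `card_quotient_span_coe_pow_sup_span_qm`: `#(Λ ⧸ (fⁿ, q_m)) = p^{n · deg f}` for `m > n · deg f`.
* `card_quotient_C_pow_quotSMulTop_qm`, `card_quotient_coe_pow_quotSMulTop_qm`,
  **`card_elementaryModule_quotSMulTop_qm`** — `#(E(μs, fs) ⧸ q_m) = p^{m Σμᵢ + Σ nⱼ deg fⱼ}` for `m ≥ 1` exceeding
  every `nⱼ deg fⱼ`.

References: [Howard2004HeegnerKolyvagin] proof of Thm. 2.2.10 (arXiv:1202.6340, p. 18); [Washington1997] §7.1
Prop. 7.2, §13.2 Lemma 13.7 / Prop. 13.8 / Thm. 13.12; [AtiyahMacdonald1969] Prop. 2.14, Prop. 2.18, Ex. 2.2.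
-/


set_option autoImplicit false

noncomputable section

open scoped Classical Pointwise Polynomial DirectSum

namespace Literature.NumberTheory.EllipticCurves

namespace Module

/-! ### Indices `#(M ⧸ I M)`: transport under `≃ₗ`, finite products and direct sums
(generic commutative ring; the exactness / `Tor` / pseudo-isomorphism comparisons are in
`IwasawaAlgebraSpecializationIndexComparisonProofs`, seat x10b-p1-w2) -/

variable {R : Type*} [CommRing R] {M M' : Type*} [AddCommGroup M] [_root_.Module R M]
  [AddCommGroup M'] [_root_.Module R M']

/-- `#(M ⧸ I M)` is invariant under linear equivalences (`M ≃ M'` induces `M ⧸ I M ≃ M' ⧸ I M'`,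
`Submodule.Quotient.equiv`). [cite: AtiyahMacdonald1969, Prop. 2.14 and Prop. 2.18 (M/IM ≅ R/I ⊗ M is functorial)] -/
theorem card_quotSMulTop_eq_of_linearEquiv (I : Ideal R) (e : M ≃ₗ[R] M') :
    Nat.card (M ⧸ (I • ⊤ : Submodule R M)) = Nat.card (M' ⧸ (I • ⊤ : Submodule R M')) :=
  Nat.card_congr (Submodule.Quotient.equiv (I • ⊤) (I • ⊤) e (by
    rw [Submodule.map_smul'', Submodule.map_top, LinearEquiv.range])).toEquiv

/-- `M ⧸ I M` is finite iff `M' ⧸ I M'` is, for `M ≃ M'` (one direction). [cite: AtiyahMacdonald1969, Prop. 2.14 and Prop. 2.18 (M/IM ≅ R/I ⊗ M is functorial)] -/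
theorem finite_quotSMulTop_of_linearEquiv (I : Ideal R) (e : M ≃ₗ[R] M')
    [Finite (M' ⧸ (I • ⊤ : Submodule R M'))] : Finite (M ⧸ (I • ⊤ : Submodule R M)) :=
  Finite.of_equiv _ (Submodule.Quotient.equiv (I • ⊤) (I • ⊤) e (by
    rw [Submodule.map_smul'', Submodule.map_top, LinearEquiv.range])).toEquiv.symm

/-- For a finite index type, `I • ⊤ = Π I • ⊤` in a product module. [cite: AtiyahMacdonald1969, Prop. 2.14 (iii) (⊗ commutes with direct sums) with Prop. 2.18] -/
theorem smul_top_eq_pi {R : Type*} [CommRing R] {ι : Type*} [Fintype ι] [DecidableEq ι]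
    (M : ι → Type*) [∀ i, AddCommGroup (M i)] [∀ i, _root_.Module R (M i)] (I : Ideal R) :
    (I • ⊤ : Submodule R (∀ i, M i)) = Submodule.pi Set.univ (fun i => (I • ⊤ : Submodule R (M i))) := by
  apply le_antisymm
  · refine Submodule.smul_le.mpr fun r hr x _ => ?_
    rw [Submodule.mem_pi]
    intro i _
    rw [Pi.smul_apply]
    exact Submodule.smul_mem_smul hr Submodule.mem_top
  · intro x hx
    rw [Submodule.mem_pi] at hx
    rw [← Finset.univ_sum_single x]
    refine Submodule.sum_mem _ fun i _ => ?_
    have hxi : x i ∈ (I • ⊤ : Submodule R (M i)) := hx i (Set.mem_univ i)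
    have : (Pi.single i (x i) : ∀ i, M i) = LinearMap.single R M i (x i) := rfl
    rw [this]
    have hle : Submodule.map (LinearMap.single R M i) (I • ⊤) ≤ (I • ⊤ : Submodule R (∀ i, M i)) := by
      rw [Submodule.map_smul'']
      exact Submodule.smul_mono le_rfl le_top
    exact hle (Submodule.mem_map_of_mem hxi)

/-- `#((Π M_i) ⧸ I) = ∏ #(M_i ⧸ I)` over a finite index type. [cite: AtiyahMacdonald1969, Prop. 2.14 (iii) (⊗ commutes with direct sums) with Prop. 2.18] -/
theorem card_pi_quotSMulTop {R : Type*} [CommRing R] {ι : Type*} [Fintype ι] [DecidableEq ι]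
    (M : ι → Type*) [∀ i, AddCommGroup (M i)] [∀ i, _root_.Module R (M i)] (I : Ideal R) :
    Nat.card ((∀ i, M i) ⧸ (I • ⊤ : Submodule R (∀ i, M i))) =
      ∏ i, Nat.card (M i ⧸ (I • ⊤ : Submodule R (M i))) := by
  rw [Nat.card_congr (Submodule.quotEquivOfEq _ _ (smul_top_eq_pi M I)).toEquiv,
    Nat.card_congr (Submodule.quotientPi (fun i => (I • ⊤ : Submodule R (M i)))).toEquiv,
    Nat.card_pi]

/-- `I • ⊤ = (I • ⊤) × (I • ⊤)` in a binary product. [cite: AtiyahMacdonald1969, Prop. 2.14 (iii) (⊗ commutes with direct sums) with Prop. 2.18] -/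
theorem smul_top_eq_prod {R : Type*} [CommRing R] (M M' : Type*) [AddCommGroup M] [_root_.Module R M]
    [AddCommGroup M'] [_root_.Module R M'] (I : Ideal R) :
    (I • ⊤ : Submodule R (M × M')) = (I • ⊤ : Submodule R M).prod (I • ⊤ : Submodule R M') := by
  apply le_antisymm
  · refine Submodule.smul_le.mpr fun r hr x _ => ?_
    rw [Submodule.mem_prod]
    exact ⟨Submodule.smul_mem_smul hr Submodule.mem_top, Submodule.smul_mem_smul hr Submodule.mem_top⟩
  · rintro ⟨x, y⟩ ⟨hx, hy⟩
    have h1 : ((x, y) : M × M') = LinearMap.inl R M M' x + LinearMap.inr R M M' y := by simp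
    rw [h1]
    refine Submodule.add_mem _ ?_ ?_
    · have hle : Submodule.map (LinearMap.inl R M M') (I • ⊤) ≤ (I • ⊤ : Submodule R (M × M')) := by
        rw [Submodule.map_smul'']
        exact Submodule.smul_mono le_rfl le_top
      exact hle (Submodule.mem_map_of_mem hx)
    · have hle : Submodule.map (LinearMap.inr R M M') (I • ⊤) ≤ (I • ⊤ : Submodule R (M × M')) := by
        rw [Submodule.map_smul'']
        exact Submodule.smul_mono le_rfl le_top
      exact hle (Submodule.mem_map_of_mem hy)

/-- `#((M × M') ⧸ I) = #(M ⧸ I) · #(M' ⧸ I)`. [cite: AtiyahMacdonald1969, Prop. 2.14 (iii) (⊗ commutes with direct sums) with Prop. 2.18] -/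
theorem card_prod_quotSMulTop {R : Type*} [CommRing R] (M M' : Type*) [AddCommGroup M] [_root_.Module R M]
    [AddCommGroup M'] [_root_.Module R M'] (I : Ideal R) :
    Nat.card ((M × M') ⧸ (I • ⊤ : Submodule R (M × M'))) =
      Nat.card (M ⧸ (I • ⊤ : Submodule R M)) * Nat.card (M' ⧸ (I • ⊤ : Submodule R M')) := by
  let f := ((I • ⊤ : Submodule R M).mkQ).prodMap ((I • ⊤ : Submodule R M').mkQ)
  have hf : Function.Surjective f := fun ⟨x, y⟩ => by
    obtain ⟨x, rfl⟩ := Submodule.mkQ_surjective _ x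
    obtain ⟨y, rfl⟩ := Submodule.mkQ_surjective _ y
    exact ⟨(x, y), rfl⟩
  have hker : LinearMap.ker f = (I • ⊤ : Submodule R (M × M')) := by
    rw [LinearMap.ker_prodMap, Submodule.ker_mkQ, Submodule.ker_mkQ, smul_top_eq_prod]
  rw [← Nat.card_prod, ← Nat.card_congr (f.quotKerEquivOfSurjective hf).toEquiv,
    Nat.card_congr (Submodule.quotEquivOfEq _ _ hker).toEquiv]

/-- `#((⨁ᵢ Mᵢ) ⧸ I) = ∏ᵢ #(Mᵢ ⧸ I)` over a finite index type. [cite: AtiyahMacdonald1969, Prop. 2.14 (iii) (⊗ commutes with direct sums) with Prop. 2.18] -/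
theorem card_directSum_quotSMulTop {R : Type*} [CommRing R] {ι : Type*} [Fintype ι] [DecidableEq ι]
    (M : ι → Type*) [∀ i, AddCommGroup (M i)] [∀ i, _root_.Module R (M i)] (I : Ideal R) :
    Nat.card ((DirectSum ι M) ⧸ (I • ⊤ : Submodule R (DirectSum ι M))) =
      ∏ i, Nat.card (M i ⧸ (I • ⊤ : Submodule R (M i))) := by
  rw [card_quotSMulTop_eq_of_linearEquiv I (DirectSum.linearEquivFunOnFintype R ι M),
    card_pi_quotSMulTop]

end Module

namespace IwasawaAlgebra

variable (p : ℕ) [Fact p.Prime]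

/-! ### Double quotients and restriction of scalars -/

/-- `#((Λ/J) ⧸ I·(Λ/J)) = #(Λ ⧸ (J ⊔ I))` (third isomorphism theorem). [cite: AtiyahMacdonald1969, Ex. 2.2 ((A/𝔞) ⊗ M ≅ M/𝔞M) and Prop. 2.18; third isomorphism theorem] -/
theorem card_quotient_quotSMulTop (I J : Ideal (IwasawaAlgebra p)) :
    Nat.card ((IwasawaAlgebra p ⧸ J) ⧸ (I • ⊤ : Submodule (IwasawaAlgebra p) (IwasawaAlgebra p ⧸ J))) =
      Nat.card (IwasawaAlgebra p ⧸ (J ⊔ I)) := by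
  have h1 : (I • ⊤ : Submodule (IwasawaAlgebra p) (IwasawaAlgebra p ⧸ J)) =
      (I.map (Ideal.Quotient.mk J)).restrictScalars (IwasawaAlgebra p) := by
    rw [Ideal.smul_top_eq_map, Ideal.Quotient.algebraMap_eq]
  rw [Nat.card_congr (Submodule.quotEquivOfEq _ _ h1).toEquiv,
    ← Nat.card_congr (Submodule.Quotient.restrictScalarsEquiv (IwasawaAlgebra p)
      (I.map (Ideal.Quotient.mk J))).toEquiv.symm]
  · exact Nat.card_congr (DoubleQuot.quotQuotEquivQuotSup J I).toEquiv


/-! ### `#(F ⧸ p^k F) = p^{k r}` for a free `ℤ_p`-module of rank `r` -/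

/-- `#(ℤ_p ⧸ p^k ℤ_p) = p^k`. [cite: Washington1997, §13.2 (Lemma 13.7, Prop. 13.8, Thm. 13.12)] -/
theorem card_padicInt_quotSMulTop_pow (k : ℕ) :
    Nat.card (ℤ_[p] ⧸ (Ideal.span {(p : ℤ_[p]) ^ k} • ⊤ : Submodule ℤ_[p] ℤ_[p])) = p ^ k := by
  rw [Ideal.smul_eq_mul, Ideal.mul_top, ← PadicInt.ker_toZModPow,
    Nat.card_congr (RingHom.quotientKerEquivOfSurjective
      (ZMod.ringHom_surjective (PadicInt.toZModPow k))).toEquiv, Nat.card_zmod]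

/-- For a finite free `ℤ_p`-module `F` of rank `r`: `#(F ⧸ p^k F) = p^{k r}`. [cite: Washington1997, §13.2 (Lemma 13.7, Prop. 13.8, Thm. 13.12)] -/
theorem card_quotSMulTop_pow_of_free (F : Type*) [AddCommGroup F] [Module ℤ_[p] F]
    [Module.Free ℤ_[p] F] [Module.Finite ℤ_[p] F] (k : ℕ) :
    Nat.card (F ⧸ (Ideal.span {(p : ℤ_[p]) ^ k} • ⊤ : Submodule ℤ_[p] F)) =
      p ^ (k * Module.finrank ℤ_[p] F) := by
  let b := Module.finBasis ℤ_[p] F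
  rw [Module.card_quotSMulTop_eq_of_linearEquiv _ b.equivFun,
    Module.card_pi_quotSMulTop (fun _ : Fin (Module.finrank ℤ_[p] F) => ℤ_[p]) _,
    Finset.prod_const, card_padicInt_quotSMulTop_pow, Finset.card_univ, Fintype.card_fin, ← pow_mul]

/-- For an ideal `J` of `Λ` with `Λ/J` free of finite rank `r` over `ℤ_p`:
`#(Λ ⧸ (J ⊔ (p^k))) = p^{k r}`. [cite: Washington1997, §13.2 (Lemma 13.7, Prop. 13.8, Thm. 13.12)] -/
theorem card_quotient_sup_span_C_pow (J : Ideal (IwasawaAlgebra p))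
    [Module.Free ℤ_[p] (IwasawaAlgebra p ⧸ J)] [Module.Finite ℤ_[p] (IwasawaAlgebra p ⧸ J)] (k : ℕ) :
    Nat.card (IwasawaAlgebra p ⧸ (J ⊔ Ideal.span {PowerSeries.C ((p : ℤ_[p]) ^ k)})) =
      p ^ (k * Module.finrank ℤ_[p] (IwasawaAlgebra p ⧸ J)) := by
  rw [← card_quotient_quotSMulTop]
  -- the `Λ`-submodule `(C p^k) • ⊤` restricted to `ℤ_p` is `p^k • ⊤`
  have h : ((Ideal.span {PowerSeries.C ((p : ℤ_[p]) ^ k)} • ⊤ :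
      Submodule (IwasawaAlgebra p) (IwasawaAlgebra p ⧸ J))).restrictScalars ℤ_[p] =
      (Ideal.span {(p : ℤ_[p]) ^ k} • ⊤ : Submodule ℤ_[p] (IwasawaAlgebra p ⧸ J)) := by
    ext x
    rw [Submodule.restrictScalars_mem, Submodule.ideal_span_singleton_smul,
      Submodule.ideal_span_singleton_smul, Submodule.mem_smul_pointwise_iff_exists,
      Submodule.mem_smul_pointwise_iff_exists]
    constructor
    · rintro ⟨y, -, rfl⟩
      refine ⟨y, Submodule.mem_top, ?_⟩
      rw [← IsScalarTower.algebraMap_smul (IwasawaAlgebra p) ((p : ℤ_[p]) ^ k) y,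
        ← PowerSeries.C_eq_algebraMap]
    · rintro ⟨y, -, rfl⟩
      refine ⟨y, Submodule.mem_top, ?_⟩
      rw [← IsScalarTower.algebraMap_smul (IwasawaAlgebra p) ((p : ℤ_[p]) ^ k) y,
        ← PowerSeries.C_eq_algebraMap]
  rw [← Nat.card_congr (Submodule.Quotient.restrictScalarsEquiv ℤ_[p]
      (Ideal.span {PowerSeries.C ((p : ℤ_[p]) ^ k)} • ⊤ :
        Submodule (IwasawaAlgebra p) (IwasawaAlgebra p ⧸ J))).toEquiv,
    Nat.card_congr (Submodule.quotEquivOfEq _ _ h).toEquiv, card_quotSMulTop_pow_of_free]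


/-! ### Howard's specialisation polynomials `q_m = X^m + p` and the cyclic pieces -/

/-- `X^m + p ∈ ℤ_p[X]` is distinguished for `m ≥ 1` (Eisenstein). [cite: Washington1997, §7.1 (distinguished polynomials) and Prop. 7.2] -/
theorem isDistinguishedAt_X_pow_add_C {m : ℕ} (hm : 1 ≤ m) :
    (Polynomial.X ^ m + Polynomial.C (p : ℤ_[p]) : ℤ_[p][X]).IsDistinguishedAt
      (IsLocalRing.maximalIdeal ℤ_[p]) := by
  have hm0 : m ≠ 0 := by omega
  refine ⟨⟨fun {i} hi => ?_⟩, Polynomial.monic_X_pow_add_C _ hm0⟩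
  rw [Polynomial.natDegree_X_pow_add_C] at hi
  rw [Polynomial.coeff_add, Polynomial.coeff_X_pow, if_neg (ne_of_lt hi), zero_add, Polynomial.coeff_C,
    PadicInt.maximalIdeal_eq_span_p]
  split_ifs
  · exact Ideal.mem_span_singleton_self _
  · exact zero_mem _

/-- The power series of `X^m + p`. [cite: Washington1997, §7.1 (distinguished polynomials) and Prop. 7.2] -/
theorem coe_X_pow_add_C (m : ℕ) :
    ((Polynomial.X ^ m + Polynomial.C (p : ℤ_[p]) : ℤ_[p][X]) : IwasawaAlgebra p) =
      PowerSeries.X ^ m + PowerSeries.C (p : ℤ_[p]) := by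
  rw [Polynomial.coe_add, Polynomial.coe_pow, Polynomial.coe_X, Polynomial.coe_C]

/-- `#(Λ ⧸ (q_m, p^k)) = p^{k m}` for `m ≥ 1` (`Λ/(q_m) ≅ ℤ_p[π]`, `π^m = -p`, free of rank `m`).
[cite: Howard2004HeegnerKolyvagin, proof of Thm. 2.2.10 (specialisation at 𝔮 = T^m + p)] [cite: Washington1997, §13.2 (Lemma 13.7, Prop. 13.8, Thm. 13.12)] -/
theorem card_quotient_span_qm_sup_span_C_pow {m : ℕ} (hm : 1 ≤ m) (k : ℕ) :
    Nat.card (IwasawaAlgebra p ⧸ (Ideal.span {(PowerSeries.X ^ m + PowerSeries.C (p : ℤ_[p]) :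
        IwasawaAlgebra p)} ⊔ Ideal.span {PowerSeries.C ((p : ℤ_[p]) ^ k)})) = p ^ (k * m) := by
  have hq := isDistinguishedAt_X_pow_add_C p hm
  have hm0 : m ≠ 0 := by omega
  haveI := free_quotient_pow p hq 1
  haveI := finite_quotient_pow p hq 1
  have h1 : Ideal.span {(PowerSeries.X ^ m + PowerSeries.C (p : ℤ_[p]) : IwasawaAlgebra p)} =
      Ideal.span {((Polynomial.X ^ m + Polynomial.C (p : ℤ_[p]) : ℤ_[p][X]) : IwasawaAlgebra p) ^ 1} := by
    rw [pow_one, coe_X_pow_add_C]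
  rw [h1, card_quotient_sup_span_C_pow, finrank_quotient_pow p hq 1, one_mul,
    Polynomial.natDegree_X_pow_add_C]

/-- For a distinguished `g` of degree `d`: `(p) ∣ g - X^d` in `Λ`. [cite: Washington1997, §7.1 (distinguished polynomials) and Prop. 7.2] -/
theorem C_dvd_coe_sub_X_pow {g : ℤ_[p][X]} (hg : g.IsDistinguishedAt (IsLocalRing.maximalIdeal ℤ_[p])) :
    (PowerSeries.C (p : ℤ_[p]) : IwasawaAlgebra p) ∣ (g : IwasawaAlgebra p) - PowerSeries.X ^ g.natDegree := by
  rw [Literature.NumberTheory.EllipticCurves.PowerSeries.C_dvd_iff_forall_dvd_coeff]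
  intro n
  rw [map_sub, Polynomial.coeff_coe, PowerSeries.coeff_X_pow]
  rcases lt_trichotomy n g.natDegree with h | h | h
  · rw [if_neg (ne_of_lt h), sub_zero, ← Ideal.mem_span_singleton, ← PadicInt.maximalIdeal_eq_span_p]
    exact hg.mem h
  · subst h
    rw [if_pos rfl, hg.monic.coeff_natDegree, sub_self]
    exact dvd_zero _
  · rw [if_neg (ne_of_gt h), sub_zero, Polynomial.coeff_eq_zero_of_natDegree_lt h]
    exact dvd_zero _

/-- **The ideal identity** `(g, q_m) = (g, p)` for a distinguished `g` of degree `d < m`: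
`X^m = X^{m-d}(g - p h₀)` and `p (1 - X^{m-d} h₀) = q_m - X^{m-d} g` with `1 - X^{m-d} h₀ ∈ Λˣ`.
[cite: Howard2004HeegnerKolyvagin, proof of Thm. 2.2.10 (specialisation at 𝔮 = T^m + p)] [cite: Washington1997, §7.1 (distinguished polynomials) and Prop. 7.2] -/
theorem span_coe_sup_span_qm_eq {g : ℤ_[p][X]} (hg : g.IsDistinguishedAt (IsLocalRing.maximalIdeal ℤ_[p]))
    {m : ℕ} (hm : g.natDegree < m) :
    Ideal.span {(g : IwasawaAlgebra p)} ⊔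
        Ideal.span {(PowerSeries.X ^ m + PowerSeries.C (p : ℤ_[p]) : IwasawaAlgebra p)} =
      Ideal.span {(g : IwasawaAlgebra p)} ⊔ Ideal.span {PowerSeries.C (p : ℤ_[p])} := by
  obtain ⟨h₀, hh₀⟩ := C_dvd_coe_sub_X_pow p hg
  set d := g.natDegree with hd
  have hXd : (PowerSeries.X : IwasawaAlgebra p) ^ d = (g : IwasawaAlgebra p) - PowerSeries.C (p : ℤ_[p]) * h₀ := by
    rw [← hh₀]; ring
  have hXm : (PowerSeries.X : IwasawaAlgebra p) ^ m = PowerSeries.X ^ (m - d) * PowerSeries.X ^ d := by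
    rw [← pow_add, Nat.sub_add_cancel hm.le]
  apply le_antisymm
  · -- `q_m ∈ (g, p)`
    refine sup_le le_sup_left ((Ideal.span_singleton_le_iff_mem _).mpr ?_)
    have : (PowerSeries.X ^ m + PowerSeries.C (p : ℤ_[p]) : IwasawaAlgebra p) =
        PowerSeries.X ^ (m - d) * (g : IwasawaAlgebra p) +
          PowerSeries.C (p : ℤ_[p]) * (1 - PowerSeries.X ^ (m - d) * h₀) := by
      rw [hXm, hXd]
      ring
    rw [this]
    exact Submodule.add_mem _
      (Ideal.mem_sup_left (Ideal.mul_mem_left _ _ (Ideal.mem_span_singleton_self _)))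
      (Ideal.mem_sup_right (Ideal.mul_mem_right _ _ (Ideal.mem_span_singleton_self _)))
  · -- `p ∈ (g, q_m)`
    refine sup_le le_sup_left ((Ideal.span_singleton_le_iff_mem _).mpr ?_)
    have hu : IsUnit (1 - PowerSeries.X ^ (m - d) * h₀ : IwasawaAlgebra p) := by
      rw [PowerSeries.isUnit_iff_constantCoeff, map_sub, map_one, map_mul, map_pow,
        PowerSeries.constantCoeff_X, zero_pow (by omega), zero_mul, sub_zero]
      exact isUnit_one
    obtain ⟨u, hu⟩ := hu
    have hkey : (PowerSeries.C (p : ℤ_[p]) : IwasawaAlgebra p) * (1 - PowerSeries.X ^ (m - d) * h₀) =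
        (PowerSeries.X ^ m + PowerSeries.C (p : ℤ_[p])) - PowerSeries.X ^ (m - d) * (g : IwasawaAlgebra p) := by
      rw [hXm, hXd]
      ring
    have hmem : (PowerSeries.C (p : ℤ_[p]) : IwasawaAlgebra p) * (1 - PowerSeries.X ^ (m - d) * h₀) ∈
        Ideal.span {(g : IwasawaAlgebra p)} ⊔
          Ideal.span {(PowerSeries.X ^ m + PowerSeries.C (p : ℤ_[p]) : IwasawaAlgebra p)} := by
      rw [hkey]
      exact Submodule.sub_mem _ (Ideal.mem_sup_right (Ideal.mem_span_singleton_self _))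
        (Ideal.mem_sup_left (Ideal.mul_mem_left _ _ (Ideal.mem_span_singleton_self _)))
    have hCp : (PowerSeries.C (p : ℤ_[p]) : IwasawaAlgebra p) =
        PowerSeries.C (p : ℤ_[p]) * (1 - PowerSeries.X ^ (m - d) * h₀) * ((u⁻¹ : (IwasawaAlgebra p)ˣ) :
          IwasawaAlgebra p) := by
      rw [← hu, mul_assoc, Units.mul_inv, mul_one]
    have hfin := Ideal.mul_mem_right ((u⁻¹ : (IwasawaAlgebra p)ˣ) : IwasawaAlgebra p) _ hmem
    rwa [← hCp] at hfin

/-- `#(Λ ⧸ (fⁿ, q_m)) = p^{n · deg f}` for a distinguished `f` and `m > n · deg f`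
(`(fⁿ, q_m) = (fⁿ, p)` and `Λ/(fⁿ)` is `ℤ_p`-free of rank `n · deg f`). [cite: Howard2004HeegnerKolyvagin, proof of Thm. 2.2.10 (specialisation at 𝔮 = T^m + p)] [cite: Washington1997, §13.2 (Lemma 13.7, Prop. 13.8, Thm. 13.12)] -/
theorem card_quotient_span_coe_pow_sup_span_qm {f : ℤ_[p][X]}
    (hf : f.IsDistinguishedAt (IsLocalRing.maximalIdeal ℤ_[p])) (n : ℕ) {m : ℕ} (hm : n * f.natDegree < m) :
    Nat.card (IwasawaAlgebra p ⧸ (Ideal.span {(f : IwasawaAlgebra p) ^ n} ⊔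
      Ideal.span {(PowerSeries.X ^ m + PowerSeries.C (p : ℤ_[p]) : IwasawaAlgebra p)})) =
        p ^ (n * f.natDegree) := by
  have hg := isDistinguishedAt_pow hf n
  have hdeg : (f ^ n).natDegree = n * f.natDegree := hf.monic.natDegree_pow n
  haveI := free_quotient_pow p hf n
  haveI := finite_quotient_pow p hf n
  have h1 : ((f ^ n : ℤ_[p][X]) : IwasawaAlgebra p) = (f : IwasawaAlgebra p) ^ n := Polynomial.coe_pow _
  rw [← h1, span_coe_sup_span_qm_eq p hg (by rw [hdeg]; exact hm), h1,
    show (PowerSeries.C (p : ℤ_[p]) : IwasawaAlgebra p) = PowerSeries.C ((p : ℤ_[p]) ^ 1) by rw [pow_one],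
    card_quotient_sup_span_C_pow, finrank_quotient_pow p hf n, one_mul]


/-! ### The elementary module `E(μs, fs)` modulo `q_m` -/

/-- The `p`-primary cyclic piece: `#((Λ/(p^μ)) ⧸ q_m) = p^{μ m}` for `m ≥ 1`. [cite: Howard2004HeegnerKolyvagin, proof of Thm. 2.2.10 (specialisation at 𝔮 = T^m + p)] [cite: Washington1997, §13.2 (Lemma 13.7, Prop. 13.8, Thm. 13.12)] -/
theorem card_quotient_C_pow_quotSMulTop_qm (μ : ℕ) {m : ℕ} (hm : 1 ≤ m) :
    Nat.card ((IwasawaAlgebra p ⧸ Ideal.span {PowerSeries.C ((p : ℤ_[p]) ^ μ)}) ⧸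
      (Ideal.span {(PowerSeries.X ^ m + PowerSeries.C (p : ℤ_[p]) : IwasawaAlgebra p)} • ⊤ :
        Submodule (IwasawaAlgebra p) (IwasawaAlgebra p ⧸ Ideal.span {PowerSeries.C ((p : ℤ_[p]) ^ μ)}))) =
      p ^ (μ * m) := by
  rw [card_quotient_quotSMulTop, sup_comm, card_quotient_span_qm_sup_span_C_pow p hm]

/-- The distinguished cyclic piece: `#((Λ/(fⁿ)) ⧸ q_m) = p^{n · deg f}` for `m > n · deg f`. [cite: Howard2004HeegnerKolyvagin, proof of Thm. 2.2.10 (specialisation at 𝔮 = T^m + p)] [cite: Washington1997, §13.2 (Lemma 13.7, Prop. 13.8, Thm. 13.12)] -/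
theorem card_quotient_coe_pow_quotSMulTop_qm {f : ℤ_[p][X]}
    (hf : f.IsDistinguishedAt (IsLocalRing.maximalIdeal ℤ_[p])) (n : ℕ) {m : ℕ} (hm : n * f.natDegree < m) :
    Nat.card ((IwasawaAlgebra p ⧸ Ideal.span {(f : IwasawaAlgebra p) ^ n}) ⧸
      (Ideal.span {(PowerSeries.X ^ m + PowerSeries.C (p : ℤ_[p]) : IwasawaAlgebra p)} • ⊤ :
        Submodule (IwasawaAlgebra p) (IwasawaAlgebra p ⧸ Ideal.span {(f : IwasawaAlgebra p) ^ n}))) =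
      p ^ (n * f.natDegree) := by
  rw [card_quotient_quotSMulTop, card_quotient_span_coe_pow_sup_span_qm p hf n hm]

/-- **`#(E(μs, fs) ⧸ q_m) = p^{m Σ μᵢ + Σ nⱼ deg fⱼ}`** for `m ≥ 1` exceeding every `nⱼ deg fⱼ`.
[cite: Washington1997, §13.2 (elementary modules)] -/
theorem card_elementaryModule_quotSMulTop_qm {μs : List ℕ} {fs : List (ℤ_[p][X] × ℕ)}
    (hfs : ∀ f ∈ fs, f.1.IsDistinguishedAt (IsLocalRing.maximalIdeal ℤ_[p])) {m : ℕ} (hm : 1 ≤ m)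
    (hm' : ∀ f ∈ fs, f.2 * f.1.natDegree < m) :
    Nat.card ((elementaryModule p μs fs) ⧸
      (Ideal.span {(PowerSeries.X ^ m + PowerSeries.C (p : ℤ_[p]) : IwasawaAlgebra p)} • ⊤ :
        Submodule (IwasawaAlgebra p) (elementaryModule p μs fs))) =
      p ^ (m * μs.sum + ∑ j : Fin fs.length, (fs.get j).2 * (fs.get j).1.natDegree) := by
  have e : elementaryModule p μs fs ≃ₗ[IwasawaAlgebra p]
      ((⨁ i : Fin μs.length,
          IwasawaAlgebra p ⧸ Ideal.span {PowerSeries.C ((p : ℤ_[p]) ^ μs.get i)}) ×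
        ⨁ j : Fin fs.length,
          IwasawaAlgebra p ⧸ Ideal.span {((fs.get j).1 : IwasawaAlgebra p) ^ (fs.get j).2}) :=
    LinearEquiv.refl _ _
  rw [Module.card_quotSMulTop_eq_of_linearEquiv
      (M' := ((⨁ i : Fin μs.length,
          IwasawaAlgebra p ⧸ Ideal.span {PowerSeries.C ((p : ℤ_[p]) ^ μs.get i)}) ×
        ⨁ j : Fin fs.length,
          IwasawaAlgebra p ⧸ Ideal.span {((fs.get j).1 : IwasawaAlgebra p) ^ (fs.get j).2})) _ e]
  rw [Module.card_prod_quotSMulTop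
      (⨁ i : Fin μs.length, IwasawaAlgebra p ⧸ Ideal.span {PowerSeries.C ((p : ℤ_[p]) ^ μs.get i)})
      (⨁ j : Fin fs.length, IwasawaAlgebra p ⧸ Ideal.span {((fs.get j).1 : IwasawaAlgebra p) ^ (fs.get j).2})
      (Ideal.span {(PowerSeries.X ^ m + PowerSeries.C (p : ℤ_[p]) : IwasawaAlgebra p)})]
  rw [Module.card_directSum_quotSMulTop, Module.card_directSum_quotSMulTop]
  rw [Finset.prod_congr rfl fun i _ => card_quotient_C_pow_quotSMulTop_qm p (μs.get i) hm,
    Finset.prod_congr rfl fun j _ =>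
      card_quotient_coe_pow_quotSMulTop_qm p (hfs _ (List.get_mem fs j)) _ (hm' _ (List.get_mem fs j)),
    Finset.prod_pow_eq_pow_sum, Finset.prod_pow_eq_pow_sum, ← pow_add, ← Finset.sum_mul, mul_comm m]
  congr 2
  simp_rw [List.get_eq_getElem]
  rw [Fin.sum_univ_getElem μs]


end IwasawaAlgebra

end Literature.NumberTheory.EllipticCurves

end
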